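import Mathlib
import Summits.NavierStokesRegularity.NavierStokesRegularity.Theorems.TypeIQuarterGateScarEnvelopeTypeIZoomDictionaryDefs
import Summits.NavierStokesRegularity.NavierStokesRegularity.Theorems.TypeIQuarterGateScarEnvelopeTypeIZoomDictionaryLemmas

/-!
# Part D: I0–I3 in the tree's currency (`ν = 1`)

Part D of the plate: I0 and I1 (from the tree theorem `SuitableCompactness_holds`), I2 from `PersistenceU`, I3 from `LocalESSU`.

PROVENANCE: declaration texts VERBATIM from the HOME plates of the instrument seat nsreg-p3 (g24/g25, cell
`pub/ns-regularity-ideate`): `round-31/Tangent31prep.lean` v5 (sha16 `e5b8668e3a090216`; = ROUND-30 plate v10 + Part K) and,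
for Part L, `round-32/Tangent32prep.lean` v6 (sha16 `6123f27718636121`);
the author cannot write under `Theorems/` (`perm.theorems-prover-only`); landed by the
LEAD-lineage prover ns-sz-p1 g5 on director-ns DIRECTOR-NS #218 (2), split into ≤ 400-line modules (the
plate's `def`s gathered in `TypeIQuarterGateScarEnvelopeTypeIZoomDictionaryDefs`), namespace
`Summit.NavierStokesRegularity.NavierStokesRegularity.Cruxes.ScarEnvelopeTypeI.ZoomDictionary` (the plate's `NsregP3.R30P`), `E3` spelled out, one-line docstrings
added where the plate had none.  `--supports stmt-NavierStokesRegularity-23843 --as helper`.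

HONEST FRAMING: dictionary / census TOOLING for the crux `TypeIQuarterGate.ScarEnvelopeTypeI` (item 23843):
equivalences and normal forms, kernel-checked; NO open statement is proved — 23843, its parent
`QuarterLawTypeI` (23726), the route and Navier–Stokes regularity are OPEN; hard core evaded: none.
-/

-- the summit-side namespace repeats a component by design (single-conjunct summit, D-0017)
set_option linter.dupNamespace false

open MeasureTheory Set Metric Filter Topology
open scoped ENNReal

namespace Summit.NavierStokesRegularity.NavierStokesRegularity.Cruxes.ScarEnvelopeTypeI.ZoomDictionary

variable {u : ℝ → (EuclideanSpace ℝ (Fin 3)) → (EuclideanSpace ℝ (Fin 3))} {a : (EuclideanSpace ℝ (Fin 3))} {ν T : ℝ}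

section UnitNormalisation

open Literature.Analysis.FluidPDE
variable {u : ℝ → (EuclideanSpace ℝ (Fin 3)) → (EuclideanSpace ℝ (Fin 3))} {p : ℝ → (EuclideanSpace ℝ (Fin 3)) → ℝ} {a : (EuclideanSpace ℝ (Fin 3))} {T : ℝ}

/-! ### I0 and I1 (I1 from the tree theorem `SuitableCompactness_holds`) -/

/-- I0 for the unit-normalised tangent flows `TangentOf`. [folklore] -/
theorem i0_tangentOf : I0 (TangentOf u p a T) := by
  intro ℓ ū h
  obtain ⟨hpos, hlim, -⟩ := h
  refine ⟨fun k => (mul_pos_iff_of_pos_left c₀_pos).1 (hpos k), ?_⟩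
  have h2 := hlim.const_mul c₀⁻¹
  simpa [inv_mul_cancel_left₀ c₀_pos.ne'] using h2

/-- Index shift: an eventual statement about `k + k₀` is an eventual statement. -/
theorem eventually_of_shift {P : ℕ → Prop} {k₀ : ℕ} (h : ∀ᶠ k in atTop, P (k + k₀)) :
    ∀ᶠ k in atTop, P k := by
  obtain ⟨N, hN⟩ := eventually_atTop.1 h
  refine eventually_atTop.2 ⟨N + k₀, fun k hk => ?_⟩
  have := hN (k - k₀) (by omega)
  rwa [Nat.sub_add_cancel (by omega)] at this

/-- **I1 from the tree's compactness theorem** (`SuitableCompactness_holds`), given that small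
zooms are in A–B's class on the unit ball with uniform `L³ × L^{3/2}` bounds. -/
theorem i1_of_suitableCompactness (hZ : ZoomsInBall u p a T) (hB : ZoomsBddU u p a T) :
    I1 (TangentOf u p a T) := by
  intro ℓ hpos hlim
  obtain ⟨L₁, hL₁, hS⟩ := hZ
  obtain ⟨C, hC, L₂, hL₂, hBd⟩ := hB
  have hLpos : ∀ k, 0 < c₀ * ℓ k := fun k => mul_pos c₀_pos (hpos k)
  have hLlim : Tendsto (fun k => c₀ * ℓ k) atTop (𝓝 0) := by simpa using hlim.const_mul c₀
  obtain ⟨k₀, hk₀⟩ : ∃ k₀, ∀ k ≥ k₀, c₀ * ℓ k ≤ min L₁ L₂ :=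
    eventually_atTop.1 (hLlim.eventually (Iic_mem_nhds (lt_min hL₁ hL₂)))
  obtain ⟨ū, pbar, σ, hσ, hR⟩ := SuitableCompactness_holds
    (fun k => zoom u a T (c₀ * ℓ (k + k₀))) (fun k => zoomP p a T (c₀ * ℓ (k + k₀)))
    (fun k => hS _ (hLpos _) ((hk₀ _ (Nat.le_add_left k₀ k)).trans (min_le_left _ _)))
    (lt_of_le_of_lt (iSup_le fun k =>
      hBd _ (hLpos _) ((hk₀ _ (Nat.le_add_left k₀ k)).trans (min_le_right _ _))) hC)
  have hφ : StrictMono fun k => σ k + k₀ := fun i j hij => Nat.add_lt_add_right (hσ hij) _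
  have hφlim : Tendsto (fun k => σ k + k₀) atTop atTop :=
    (tendsto_add_atTop_nat k₀).comp hσ.tendsto_atTop
  refine ⟨fun k => σ k + k₀, hφ, ū, fun k => hLpos _, hLlim.comp hφlim, pbar, fun R hR' => ?_⟩
  exact hR R hR'

/-! ### I2 from `PersistenceU` -/

/-- Points of the unit annulus shrink into the ball of radius `e/c₀` under `c₀⁻¹ •`. [folklore] -/
theorem norm_inv_smul_unitAnn_le {y : (EuclideanSpace ℝ (Fin 3))} (hy : y ∈ unitAnn) : ‖c₀⁻¹ • y‖ ≤ Real.exp 1 / c₀ := by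
  rw [norm_smul, norm_inv, Real.norm_eq_abs, abs_of_pos c₀_pos, div_eq_inv_mul]
  exact mul_le_mul_of_nonneg_left hy.2 (inv_nonneg.2 c₀_pos.le)

/-- The radius-`c₀⁻¹` cylinder at `(0, c₀⁻¹ y)`, `y` in the closed unit annulus, lies in `Q_{1/2}(0)`. -/
theorem cyl_unitAnn_subset_half {y : (EuclideanSpace ℝ (Fin 3))} (hy : y ∈ unitAnn) {r : ℝ} (hr : 0 < r) (hr' : r ≤ c₀⁻¹) :
    parabolicCylinder r ((0 : ℝ), c₀⁻¹ • y) ⊆ parabolicCylinder (1 / 2) (0 : ℝ × (EuclideanSpace ℝ (Fin 3))) := by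
  have hc := sixteen_lt_c₀
  have hinv : c₀⁻¹ < 1 / 16 := by
    rw [inv_lt_comm₀ c₀_pos (by norm_num)]; norm_num; exact hc
  have hy' := norm_inv_smul_unitAnn_le hy
  have he := exp_one_lt
  have h3 : Real.exp 1 / c₀ ≤ 2.72 / 16 :=
    div_le_div₀ (by norm_num) he.le (by norm_num) hc.le
  refine parabolicCylinder_subset_zero (by nlinarith) (by linarith)

/-- Small cylinders at shrunken annulus points lie inside the unit cylinder `Q_1(0)`. [folklore] -/
theorem cyl_unitAnn_subset_one {y : (EuclideanSpace ℝ (Fin 3))} (hy : y ∈ unitAnn) {r : ℝ} (hr : 0 < r) (hr' : r ≤ c₀⁻¹) :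
    parabolicCylinder r ((0 : ℝ), c₀⁻¹ • y) ⊆ parabolicCylinder 1 (0 : ℝ × (EuclideanSpace ℝ (Fin 3))) :=
  (cyl_unitAnn_subset_half hy hr hr').trans
    (parabolicCylinder_subset_zero (y := (0 : (EuclideanSpace ℝ (Fin 3)))) (by norm_num) (by norm_num))

/-- **I2 from `PersistenceU`** (plus: small zooms in A–B's class with uniform bounds — to feed
the fact's hypotheses on the approximating sequence — and continuity of `u` on the strip, to turn
the essential bound into a pointwise one). -/
theorem i2_of_persistenceU (hT : 0 < T)
    (hcont : ContinuousOn (Function.uncurry u) (Ioo 0 T ×ˢ univ)) (F2 : PersistenceU)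
    (hZ : ZoomsInBall u p a T) (hB : ZoomsBddU u p a T) : I2 u a T RegU (TangentOf u p a T) := by
  intro ℓ ū y hy hTan hreg
  obtain ⟨hpos, hlim, pbar, hR⟩ := hTan
  obtain ⟨hIB, -, hconv, hweak⟩ := hR (1 / 2) ⟨by norm_num, by norm_num⟩
  obtain ⟨L₁, hL₁, hS⟩ := hZ
  obtain ⟨C, hC, L₂, hL₂, hBd⟩ := hB
  obtain ⟨k₀, hk₀⟩ : ∃ k₀, ∀ k ≥ k₀, c₀ * ℓ k ≤ min L₁ L₂ :=
    eventually_atTop.1 (hlim.eventually (Iic_mem_nhds (lt_min hL₁ hL₂)))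
  set y' : (EuclideanSpace ℝ (Fin 3)) := c₀⁻¹ • y with hy'
  set ρ : ℝ := c₀⁻¹ with hρ
  have hρpos : 0 < ρ := inv_pos.2 c₀_pos
  set A : Set (ℝ × (EuclideanSpace ℝ (Fin 3))) := parabolicCylinder ρ ((0 : ℝ), y') with hA
  have hA1 : A ⊆ parabolicCylinder 1 (0 : ℝ × (EuclideanSpace ℝ (Fin 3))) := cyl_unitAnn_subset_one hy hρpos le_rfl
  have hA2 : A ⊆ parabolicCylinder (1 / 2) (0 : ℝ × (EuclideanSpace ℝ (Fin 3))) := cyl_unitAnn_subset_half hy hρpos le_rfl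
  have hAm : MeasurableSet A := measurableSet_parabolicCylinder' _ _
  -- the shifted approximating sequence
  set v : ℕ → ℝ → (EuclideanSpace ℝ (Fin 3)) → (EuclideanSpace ℝ (Fin 3)) := fun k => zoom u a T (c₀ * ℓ (k + k₀)) with hv
  set q : ℕ → ℝ → (EuclideanSpace ℝ (Fin 3)) → ℝ := fun k => zoomP p a T (c₀ * ℓ (k + k₀)) with hq
  have hk : ∀ k, c₀ * ℓ (k + k₀) ≤ min L₁ L₂ := fun k => hk₀ _ (Nat.le_add_left k₀ k)
  have h1 : ∀ k, IsSuitableWeakSolutionInBall ρ ((0 : ℝ), y') (v k) (q k) := fun k =>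
    (hS _ (hpos _) ((hk k).trans (min_le_left _ _))).of_subset_zero hρpos hA1
  have h2 : IsSuitableWeakSolutionInBall ρ ((0 : ℝ), y') ū pbar := hIB.of_subset_zero hρpos hA2
  have hμ1 : volume.restrict A ≤ volume.restrict (parabolicCylinder 1 (0 : ℝ × (EuclideanSpace ℝ (Fin 3)))) :=
    Measure.restrict_mono hA1 le_rfl
  have hμ2 : volume.restrict A ≤ volume.restrict (parabolicCylinder (1 / 2) (0 : ℝ × (EuclideanSpace ℝ (Fin 3)))) :=
    Measure.restrict_mono hA2 le_rfl
  have h3 : (⨆ k, eLpNorm (Function.uncurry (v k)) 3 (volume.restrict A) +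
      eLpNorm (Function.uncurry (q k)) (3 / 2) (volume.restrict A)) < ⊤ := by
    refine lt_of_le_of_lt (iSup_le fun k => ?_) hC
    exact (add_le_add (eLpNorm_mono_measure _ hμ1) (eLpNorm_mono_measure _ hμ1)).trans
      (hBd _ (hpos _) ((hk k).trans (min_le_right _ _)))
  have h4 : Tendsto (fun k => eLpNorm (Function.uncurry (v k) - Function.uncurry ū) 3
      (volume.restrict A)) atTop (𝓝 0) := by
    have h := hconv.comp (tendsto_add_atTop_nat k₀)
    exact tendsto_of_tendsto_of_tendsto_of_le_of_le tendsto_const_nhds h (fun _ => zero_le)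
      (fun k => eLpNorm_mono_measure _ hμ2)
  have h5 : ∀ g : ℝ × (EuclideanSpace ℝ (Fin 3)) → ℝ, MemLp g 3 (volume.restrict A) →
      Tendsto (fun k => ∫ w in A, q k w.1 w.2 * g w) atTop (𝓝 (∫ w in A, pbar w.1 w.2 * g w)) := by
    intro g hg
    have hg' : MemLp (A.indicator g) 3 (volume.restrict (parabolicCylinder (1 / 2) (0 : ℝ × (EuclideanSpace ℝ (Fin 3))))) := by
      rw [memLp_indicator_iff_restrict hAm, Measure.restrict_restrict hAm, inter_eq_left.2 hA2]
      exact hg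
    have key : ∀ f : ℝ × (EuclideanSpace ℝ (Fin 3)) → ℝ,
        ∫ w in parabolicCylinder (1 / 2) (0 : ℝ × (EuclideanSpace ℝ (Fin 3))), f w * A.indicator g w = ∫ w in A, f w * g w := by
      intro f
      have : (fun w => f w * A.indicator g w) = A.indicator (fun w => f w * g w) := by
        funext w; by_cases hw : w ∈ A <;> simp [hw]
      rw [this, setIntegral_indicator hAm, inter_eq_right.2 hA2]
    have h := (hweak _ hg').comp (tendsto_add_atTop_nat k₀)
    rw [key] at h
    refine (h.congr fun k => ?_)
    exact key _
  obtain ⟨r, hr, M, hM⟩ := F2 v q ū pbar y' ρ hρpos h1 h2 h3 h4 h5 hreg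
  -- pointwise bound for the zooms at scale `ℓ` near `y`
  refine ⟨c₀ * r, mul_pos c₀_pos hr, c₀⁻¹ * M, ?_⟩
  have hlim' : Tendsto (fun k => c₀ * ℓ (k + k₀)) atTop (𝓝 0) :=
    hlim.comp (tendsto_add_atTop_nat k₀)
  have hev : ∀ᶠ k in atTop, ∀ s ∈ Ioo (-((c₀ * r) ^ 2)) 0, ∀ z ∈ ball y (c₀ * r),
      ‖zoom u a T (ℓ (k + k₀)) s z‖ ≤ c₀⁻¹ * M := by
    filter_upwards [hM, eventually_sq_mul_lt hlim' hT (r ^ 2)] with k hk hkT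
    have hcz : ContinuousOn (Function.uncurry (v k)) ((Ioo (-(r ^ 2)) 0 ×ˢ ball y' r)) :=
      continuousOn_zoom hcont (hpos (k + k₀)) y' hkT
    have hk' : ∀ᵐ z ∂(volume.restrict ((Ioo (-(r ^ 2)) 0 ×ˢ ball y' r))), ‖Function.uncurry (v k) z‖ ≤ M := by
      rw [Ioo_prod_ball_eq_parabolicCylinder]; exact hk
    have hpt := norm_le_of_ae_of_continuousOn ((isOpen_Ioo.prod isOpen_ball)) hcz hk'
    intro s hs z hz
    rw [zoom_eq_inv_smul_zoom_mul c₀_pos.ne' u a T (ℓ (k + k₀)) s z, norm_smul, norm_inv,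
      Real.norm_eq_abs, abs_of_pos c₀_pos]
    refine mul_le_mul_of_nonneg_left (hpt (s / c₀ ^ 2, c₀⁻¹ • z) ⟨?_, ?_⟩) (inv_nonneg.2 c₀_pos.le)
    · have hc2 : 0 < c₀ ^ 2 := pow_pos c₀_pos 2
      constructor
      · rw [lt_div_iff₀ hc2]; nlinarith [hs.1]
      · exact div_neg_of_neg_of_pos hs.2 hc2
    · rw [mem_ball, dist_eq_norm, ← smul_sub, norm_smul, norm_inv, Real.norm_eq_abs,
        abs_of_pos c₀_pos, ← dist_eq_norm]
      rw [mem_ball] at hz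
      rw [inv_mul_lt_iff₀ c₀_pos]
      exact hz
  exact eventually_of_shift (P := fun k => ∀ s ∈ Ioo (-((c₀ * r) ^ 2)) 0, ∀ z ∈ ball y (c₀ * r),
      ‖zoom u a T (ℓ k) s z‖ ≤ c₀⁻¹ * M) hev

/-! ### I3 from `LocalESSU` -/

/-- `∫ ‖f‖³ = ‖f‖_{L³}³` in `ℝ≥0∞`. [folklore] -/
theorem lintegral_cube_eq_eLpNorm_rpow {α : Type*} [MeasurableSpace α] (μ : Measure α)
    (f : α → (EuclideanSpace ℝ (Fin 3))) : ∫⁻ x, ‖f x‖ₑ ^ (3 : ℝ) ∂μ = eLpNorm f 3 μ ^ (3 : ℝ) := by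
  rw [eLpNorm_eq_eLpNorm' (by norm_num) (by norm_num : (3 : ℝ≥0∞) ≠ ⊤)]
  rw [show ((3 : ℝ≥0∞)).toReal = 3 by norm_num]
  exact lintegral_rpow_enorm_eq_rpow_eLpNorm' (by norm_num)

/-- `L³` convergence to `0` in `eLpNorm` form gives convergence of the cube integrals to `0`. [folklore] -/
theorem tendsto_lintegral_cube_of_eLpNorm {F : ℕ → ℝ × (EuclideanSpace ℝ (Fin 3)) → (EuclideanSpace ℝ (Fin 3))} {μ : Measure (ℝ × (EuclideanSpace ℝ (Fin 3)))}
    (h : Tendsto (fun k => eLpNorm (F k) 3 μ) atTop (𝓝 0)) :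
    Tendsto (fun k => ∫⁻ z, ‖F k z‖ₑ ^ (3 : ℝ) ∂μ) atTop (𝓝 0) := by
  have h3 : Tendsto (fun k => eLpNorm (F k) 3 μ ^ (3 : ℝ)) atTop (𝓝 ((0 : ℝ≥0∞) ^ (3 : ℝ))) :=
    (ENNReal.continuous_rpow_const.tendsto 0).comp h
  rw [ENNReal.zero_rpow_of_pos (by norm_num)] at h3
  simp only [← lintegral_cube_eq_eLpNorm_rpow] at h3
  exact h3

/-- Slice `L³` integrals under the fixed dilation `x ↦ c₀ x` (scale-invariant in 3D up to the
bookkeeping constant `‖c₀‖ₑ³ · c₀⁻³`). -/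
theorem lintegral_ball_zoom_mul (u : ℝ → (EuclideanSpace ℝ (Fin 3)) → (EuclideanSpace ℝ (Fin 3))) (a : (EuclideanSpace ℝ (Fin 3))) (T ℓ s : ℝ) (y : (EuclideanSpace ℝ (Fin 3))) (ρ : ℝ) :
    ∫⁻ x in ball (c₀⁻¹ • y) ρ, ‖zoom u a T (c₀ * ℓ) s x‖ₑ ^ (3 : ℝ) =
      ‖c₀‖ₑ ^ (3 : ℝ) * (ENNReal.ofReal ((c₀ ^ 3)⁻¹) *
        ∫⁻ x in ball y (c₀ * ρ), ‖zoom u a T ℓ (c₀ ^ 2 * s) x‖ₑ ^ (3 : ℝ)) := by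
  set G : (EuclideanSpace ℝ (Fin 3)) → ℝ≥0∞ := fun x => ‖zoom u a T ℓ (c₀ ^ 2 * s) x‖ₑ ^ (3 : ℝ) with hG
  have hpt : ∀ x, ‖zoom u a T (c₀ * ℓ) s x‖ₑ ^ (3 : ℝ) = ‖c₀‖ₑ ^ (3 : ℝ) * G (c₀ • x) := by
    intro x
    rw [zoom_mul, enorm_smul, ENNReal.mul_rpow_of_nonneg _ _ (by norm_num)]
  simp_rw [hpt]
  rw [lintegral_const_mul' _ _ (by simp)]
  congr 1
  have hpre := space_affine_preimage_ball c₀_pos (0 : (EuclideanSpace ℝ (Fin 3))) y (c₀ * ρ)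
  simp only [zero_add, sub_zero, mul_div_cancel_left₀ ρ c₀_pos.ne'] at hpre
  have hcv := setLIntegral_preimage_comp_space_affine c₀_pos (0 : (EuclideanSpace ℝ (Fin 3))) G (ball y (c₀ * ρ))
  simp only [zero_add, finrank_euclideanSpace_fin] at hcv
  rw [← hpre, hcv]

/-- **I3 from `LocalESSU`** (plus continuity of `u` on the strip, for measurable zoom slices). -/
theorem i3_of_localESSU (hT : 0 < T)
    (hcont : ContinuousOn (Function.uncurry u) (Ioo 0 T ×ˢ univ)) (F3 : LocalESSU) :
    I3 u a T RegU (TangentOf u p a T) := by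
  intro ℓ ū hTan hyp y hy
  obtain ⟨hpos, hlim, pbar, hR⟩ := hTan
  obtain ⟨hIB, hMem, hconv, -⟩ := hR (1 / 2) ⟨by norm_num, by norm_num⟩
  obtain ⟨q, τ, hτ, hev⟩ := hyp
  have hc := c₀_pos
  have hcinv : 0 < c₀⁻¹ := inv_pos.2 hc
  set y' : (EuclideanSpace ℝ (Fin 3)) := c₀⁻¹ • y with hy'
  set τ' : ℝ := τ / c₀ ^ 2 with hτ'
  have hτ'pos : 0 < τ' := div_pos hτ (pow_pos hc 2)
  set ρ : ℝ := min (c₀⁻¹ / 4) (min τ' 1) with hρdef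
  have hρpos : 0 < ρ := lt_min (by positivity) (lt_min hτ'pos one_pos)
  have hρ4 : ρ ≤ c₀⁻¹ / 4 := min_le_left _ _
  have hρτ : ρ ≤ τ' := (min_le_right _ _).trans (min_le_left _ _)
  have hρone : ρ ≤ 1 := (min_le_right _ _).trans (min_le_right _ _)
  have hρsq : ρ ^ 2 ≤ τ' := by nlinarith
  have hρc : ρ ≤ c₀⁻¹ := by linarith
  have hcρ : c₀ * ρ ≤ 1 / 4 := by
    have := mul_le_mul_of_nonneg_left hρ4 hc.le
    rwa [mul_div_assoc', mul_inv_cancel₀ hc.ne'] at this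
  set A : Set (ℝ × (EuclideanSpace ℝ (Fin 3))) := parabolicCylinder ρ ((0 : ℝ), y') with hA
  have hA2 : A ⊆ parabolicCylinder (1 / 2) (0 : ℝ × (EuclideanSpace ℝ (Fin 3))) := cyl_unitAnn_subset_half hy hρpos hρc
  have hAeq : A = (Ioo (-(ρ ^ 2)) 0 ×ˢ ball y' ρ) := (Ioo_prod_ball_eq_parabolicCylinder y' ρ).symm
  have h2 : IsSuitableWeakSolutionInBall ρ ((0 : ℝ), y') ū pbar := hIB.of_subset_zero hρpos hA2
  have hμ2 : volume.restrict A ≤ volume.restrict (parabolicCylinder (1 / 2) (0 : ℝ × (EuclideanSpace ℝ (Fin 3)))) :=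
    Measure.restrict_mono hA2 le_rfl
  -- the bound
  set B : ℝ≥0∞ := ENNReal.ofReal q + ENNReal.ofReal q with hBdef
  have hBtop : B < ⊤ := ENNReal.add_lt_top.2 ⟨ENNReal.ofReal_lt_top, ENNReal.ofReal_lt_top⟩
  set B' : ℝ≥0∞ := ‖c₀‖ₑ ^ (3 : ℝ) * (ENNReal.ofReal ((c₀ ^ 3)⁻¹) * B) with hB'def
  have hB'top : B' < ⊤ :=
    ENNReal.mul_lt_top (ENNReal.rpow_lt_top_of_nonneg (by norm_num) (by simp))
      (ENNReal.mul_lt_top ENNReal.ofReal_lt_top hBtop)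
  -- L³ convergence on `A`, slice extraction
  have hconvA' : Tendsto (fun k => eLpNorm (Function.uncurry (zoom u a T (c₀ * ℓ k)) -
      Function.uncurry ū) 3 (volume.restrict A)) atTop (𝓝 0) :=
    tendsto_of_tendsto_of_tendsto_of_le_of_le tendsto_const_nhds hconv (fun _ => zero_le)
      (fun k => eLpNorm_mono_measure _ hμ2)
  have hconvA : Tendsto (fun k => ∫⁻ z in (Ioo (-(ρ ^ 2)) 0 ×ˢ ball y' ρ),
      ‖zoom u a T (c₀ * ℓ k) z.1 z.2 - ū z.1 z.2‖ₑ ^ (3 : ℝ)) atTop (𝓝 0) := by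
    rw [← hAeq]; exact tendsto_lintegral_cube_of_eLpNorm hconvA'
  have hūA : AEStronglyMeasurable (Function.uncurry ū) (volume.restrict ((Ioo (-(ρ ^ 2)) 0 ×ˢ ball y' ρ))) := by
    rw [← hAeq]; exact hMem.aestronglyMeasurable.mono_measure hμ2
  have hF : ∀ᶠ k in atTop, AEMeasurable
      (fun z : ℝ × (EuclideanSpace ℝ (Fin 3)) => ‖zoom u a T (c₀ * ℓ k) z.1 z.2 - ū z.1 z.2‖ₑ ^ (3 : ℝ))
      (volume.restrict (Ioo (-(ρ ^ 2)) 0 ×ˢ ball y' ρ)) := by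
    filter_upwards [eventually_sq_mul_lt hlim hT (ρ ^ 2)] with k hk
    have hz : AEStronglyMeasurable (Function.uncurry (zoom u a T (c₀ * ℓ k)))
        (volume.restrict ((Ioo (-(ρ ^ 2)) 0 ×ˢ ball y' ρ))) :=
      (continuousOn_zoom hcont (hpos k) y' hk).aestronglyMeasurable ((measurableSet_Ioo.prod measurableSet_ball))
    exact ((hz.sub hūA).enorm.pow_const _).congr (ae_of_all _ fun z => rfl)
  obtain ⟨φ, hφ, hsl⟩ := exists_subseq_ae_slice_tendsto hF hconvA
  have hmu : ∀ᵐ s ∂(volume.restrict (Ioo (-(ρ ^ 2)) 0)),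
      AEMeasurable (fun x => ū s x) (volume.restrict (ball y' ρ)) := ae_slice_aemeasurable hūA
  -- the slice bound for `ū`
  have hslice : ∀ᵐ s ∂(volume.restrict (Ioo (-(ρ ^ 2)) 0)),
      ∫⁻ x in ball y' ρ, ‖ū s x‖ₑ ^ (3 : ℝ) ≤ B' := by
    filter_upwards [hsl, ae_restrict_mem measurableSet_Ioo, hmu] with s hs1 hs2 hs3
    have hsτ : c₀ ^ 2 * s ∈ Ioo (-τ) 0 := by
      have hc2 : 0 < c₀ ^ 2 := pow_pos hc 2
      constructor
      · have : -τ' < s := by linarith [hs2.1]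
        have h' := mul_lt_mul_of_pos_left this hc2
        rwa [hτ', mul_neg, mul_div_cancel₀ _ hc2.ne'] at h'
      · exact mul_neg_of_pos_of_neg hc2 hs2.2
    set A' : ℝ≥0∞ := ∫⁻ x in ball y' ρ, ‖ū s x‖ₑ ^ (3 : ℝ) with hA'def
    set ε : ℕ → ℝ≥0∞ := fun k => ∫⁻ x in ball y' ρ,
      ‖zoom u a T (c₀ * ℓ (φ k)) s x - ū s x‖ₑ ^ (3 : ℝ) with hεdef
    have hevφ : ∀ᶠ k in atTop, ∀ s ∈ Ioo (-τ) 0, ∀ r ∈ Icc (1 / 2 : ℝ) 2,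
        octaveCube (zoom u a T (ℓ (φ k))) 0 r s ≤ ENNReal.ofReal q := hφ.tendsto_atTop.eventually hev
    have hsqφ : ∀ᶠ k in atTop, (c₀ * ℓ (φ k)) ^ 2 < T :=
      hφ.tendsto_atTop.eventually (eventually_sq_lt hlim hT)
    have hevA : ∀ᶠ k in atTop, A' ^ (1 / (3 : ℝ)) ≤ B' ^ (1 / (3 : ℝ)) + ε k ^ (1 / (3 : ℝ)) := by
      filter_upwards [hevφ, hsqφ] with k hk hkT
      have hsT : 0 < T + (c₀ * ℓ (φ k)) ^ 2 * s := by
        nlinarith [mul_pos (pow_pos (hpos (φ k)) 2) (by nlinarith [hs2.1] : (0 : ℝ) < s + 1)]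
      -- slice bound for the zoom at scale `c₀ ℓ` on `ball y' ρ`, via the zoom at scale `ℓ`
      have hzb : ∫⁻ x in ball y' ρ, ‖zoom u a T (c₀ * ℓ (φ k)) s x‖ₑ ^ (3 : ℝ) ≤ B' := by
        rw [hy', lintegral_ball_zoom_mul]
        refine mul_le_mul' le_rfl (mul_le_mul' le_rfl ?_)
        calc ∫⁻ x in ball y (c₀ * ρ), ‖zoom u a T (ℓ (φ k)) (c₀ ^ 2 * s) x‖ₑ ^ (3 : ℝ)
            ≤ ∫⁻ x in octAnn (0 : (EuclideanSpace ℝ (Fin 3))) (1 / 2) ∪ octAnn 0 (13 / 10),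
                ‖zoom u a T (ℓ (φ k)) (c₀ ^ 2 * s) x‖ₑ ^ (3 : ℝ) :=
              lintegral_mono_set ((ball_subset_ball hcρ).trans (ball_subset_two_octAnn hy))
          _ ≤ (∫⁻ x in octAnn (0 : (EuclideanSpace ℝ (Fin 3))) (1 / 2), ‖zoom u a T (ℓ (φ k)) (c₀ ^ 2 * s) x‖ₑ ^ (3 : ℝ)) +
                ∫⁻ x in octAnn (0 : (EuclideanSpace ℝ (Fin 3))) (13 / 10), ‖zoom u a T (ℓ (φ k)) (c₀ ^ 2 * s) x‖ₑ ^ (3 : ℝ) :=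
              lintegral_union_le _ _ _
          _ ≤ B := add_le_add (hk _ hsτ (1 / 2) ⟨le_rfl, by norm_num⟩)
                (hk _ hsτ (13 / 10) ⟨by norm_num, by norm_num⟩)
      have hf : AEMeasurable (fun x => ‖zoom u a T (c₀ * ℓ (φ k)) s x‖ₑ)
          (volume.restrict (ball y' ρ)) :=
        (measurable_zoom_slice hcont (hpos (φ k)) hs2.2 hsT).enorm.aemeasurable
      have hg : AEMeasurable (fun x => ‖ū s x - zoom u a T (c₀ * ℓ (φ k)) s x‖ₑ)
          (volume.restrict (ball y' ρ)) :=
        (hs3.sub (measurable_zoom_slice hcont (hpos (φ k)) hs2.2 hsT).aemeasurable).enorm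
      have hmink := ENNReal.lintegral_Lp_add_le hf hg (by norm_num : (1 : ℝ) ≤ 3)
      have hpt : ∀ x, ‖ū s x‖ₑ ^ (3 : ℝ) ≤
          ((fun x => ‖zoom u a T (c₀ * ℓ (φ k)) s x‖ₑ) +
            fun x => ‖ū s x - zoom u a T (c₀ * ℓ (φ k)) s x‖ₑ) x ^ (3 : ℝ) := by
        intro x
        apply ENNReal.rpow_le_rpow _ (by norm_num)
        simp only [Pi.add_apply]
        calc ‖ū s x‖ₑ = ‖zoom u a T (c₀ * ℓ (φ k)) s x +
              (ū s x - zoom u a T (c₀ * ℓ (φ k)) s x)‖ₑ := by rw [add_sub_cancel]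
          _ ≤ _ := enorm_add_le _ _
      have hA : A' ^ (1 / (3 : ℝ)) ≤ (∫⁻ x in ball y' ρ,
          ((fun x => ‖zoom u a T (c₀ * ℓ (φ k)) s x‖ₑ) +
            fun x => ‖ū s x - zoom u a T (c₀ * ℓ (φ k)) s x‖ₑ) x ^ (3 : ℝ)) ^ (1 / (3 : ℝ)) :=
        ENNReal.rpow_le_rpow (lintegral_mono fun x => hpt x) (by norm_num)
      have hε : (∫⁻ x in ball y' ρ, ‖ū s x - zoom u a T (c₀ * ℓ (φ k)) s x‖ₑ ^ (3 : ℝ)) = ε k := by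
        simp only [hεdef, enorm_sub_rev]
      calc A' ^ (1 / (3 : ℝ)) ≤ _ := hA
        _ ≤ _ := hmink
        _ ≤ B' ^ (1 / (3 : ℝ)) + ε k ^ (1 / (3 : ℝ)) :=
            add_le_add (ENNReal.rpow_le_rpow hzb (by norm_num))
              (ENNReal.rpow_le_rpow hε.le (by norm_num))
    have hεlim : Tendsto (fun k => B' ^ (1 / (3 : ℝ)) + ε k ^ (1 / (3 : ℝ))) atTop
        (𝓝 (B' ^ (1 / (3 : ℝ)) + (0 : ℝ≥0∞) ^ (1 / (3 : ℝ)))) :=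
      tendsto_const_nhds.add ((ENNReal.continuous_rpow_const.tendsto 0).comp hs1)
    rw [ENNReal.zero_rpow_of_pos (by norm_num), add_zero] at hεlim
    have hA3 : A' ^ (1 / (3 : ℝ)) ≤ B' ^ (1 / (3 : ℝ)) := ge_of_tendsto hεlim hevA
    exact (ENNReal.rpow_le_rpow_iff (by norm_num : (0 : ℝ) < 1 / 3)).1 hA3
  obtain ⟨M, hM⟩ := F3 ū pbar y' ρ hρpos h2 ⟨B', hB'top, hslice⟩
  exact ⟨ρ / 2, by positivity, M, hM⟩

end UnitNormalisation

end Summit.NavierStokesRegularity.NavierStokesRegularity.Cruxes.ScarEnvelopeTypeI.ZoomDictionary
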